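/-
Copyright (c) 2026 the pub-hodgecm-mathlib formalisation cell (harness21).  Prover seat hodgecm-mathlib-K2E3-p11 (g3), HCML Track B «K2-LIT»,
h413 = `stmt-HodgeConjecture-24833`, line `K2_E3_EllipticInputs`, unit U12 «Characters», socket #11 `sig_K2E3CharLocIntNearSemisimple`, road (11-PS) by class:
leaf (3c) «STEINBERG-TYPE CLASSES» of this seat's ROW-11 RESIDUAL CENSUS (`K2/K2E3-p11/g3/CENSUS-ROW11-residual.v1.K2E3-p11-g3.md`, dealer K2E3-plan (g2) D38).  2026-09-04.
-/
import Summits.HodgeConjecture.HodgeConjecture.Theorems.K2E3CharLocIntDifferenceOfRepresented   -- ★ p856814 (this seat) FILE 4: `charLocIntNearSemisimple_of_smoothTrace_eq_cmPrincipalSeries_sub_finite`; brings ★ p855012 `charLocIntNear_of_finite`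
import Summits.HodgeConjecture.HodgeConjecture.Theorems.F0P3cStCharTSStJH                         -- ★ «ST-JH★» `exists_centerChar_comp_eq`, `continuous_of_continuous_val`; brings ★ «ST-PIN★» `exists_stDetFields`, ★ `smoothTrace_eq_add_of_constituents_eq_pair`
import Summits.HodgeConjecture.HodgeConjecture.Theorems.F0P3U3PrincipalSeriesLettersHold           -- ★ N3 `u3PrincipalSeriesLengthLeTwo_holds` (no 3-chains in `i_G(χ)`)
import Summits.HodgeConjecture.HodgeConjecture.Theorems.F0P3XiUnramNonsplitInstance                -- ★ `isAdmissible_cmPrincipalSeries`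
import Literature.NumberTheory.Automorphic.CMPrincipalSeriesJacquetEvalOne                          -- ★ `continuous_cmTorusCharPair_apply`
import Literature.NumberTheory.Automorphic.CMLocalRingModulusContinuous                            -- ★ `continuous_halfModulusChar_apply`
import HarnessLib

/-!
# h413 ∕ Track B «K2-LIT», unit U12, socket #11, road (11-PS) by class — LEAF (3c): THE CHARACTER OF EVERY CONSTITUENT OF A CASE-(1) PRINCIPAL SERIES
# `i_G(χ_St(ψ₀))` OF `U(Φ₃)(L⁺_v)` (`v` non-split) — the Steinberg-type class `St_G(ψ)` and the one-dimensional class `ψ∘det` — IS A LOCALLY INTEGRABLE FUNCTION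
# REPRESENTING THE TRACE NEAR EVERY SEMISIMPLE POINT (socket #11 token for token)  (Rogawski 1990 §12.2 (1); Harish-Chandra ∕ van Dijk 1972; Casselman 1995 Cor. 7.1.2)

Cell `pub/hodgecm-mathlib`, crux H413 = `stmt-HodgeConjecture-24833`, route of record `HCCMUnconditional`; chair K2-lead (g0), dealer K2E3-plan (g2).  THEOREMS ONLY (no
`def`, no `instance`, no `notation`, no named-fact hypothesis, no `sorry`); lane `--supports stmt-HodgeConjecture-24833 --as helper`, count-neutral.

THE MATHEMATICS.  At a non-split `v`, for a character `ψ₀` of `E¹_v` with continuous value, the principal series `i_G(χ_St(ψ₀))`, `χ_St = (‖·‖_E^{-1}, ψ₀)` in the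
tree's normalised currency `cmTorusCharPair L v (halfModulusChar · halfModulusChar)⁻¹ ψ₀`, has EXACTLY the two constituents `St_G(ψ)` and `ψ∘det_G` (`ψ` the central
character through `ψ₀`) — ★ «ST-PIN★» `F0P3cStCharTSStPin.exists_stDetFields` (fields `ι, detZ, detG, stG` with `detG ψ = ⟦ℂ_{ψ∘detZ}⟧`, `stG ψ ≠ detG ψ` and the JH clause)
read at `ψ₀` by ★ «ST-JH★» — and no 3-chains (★ N3 `u3PrincipalSeriesLengthLeTwo_holds`), so by the additivity of the distribution character along a length-two
Jordan–Hölder series (★ `F0P3cStCharTSPs2Kind3.smoothTrace_eq_add_of_constituents_eq_pair`, admissibility ★ `isAdmissible_cmPrincipalSeries`)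
`Tr St_G(ψ)(f) = Tr i_G(χ_St(ψ₀))(f) − Tr ℂ_{ψ∘det}(f)` for every test function `f`.  The right-hand side is represented by the `L¹_loc` function
`Θ_{χ_St} − ψ∘det` (★ p856769 van Dijk's theorem for `Tr i_G(χ)`; ★ p855012 for finite-dimensional classes), which is ★ p856814
`charLocIntNearSemisimple_of_smoothTrace_eq_cmPrincipalSeries_sub_finite` with `π₁ = ℂ_{ψ∘detZ}`; the class `ψ∘det` itself is ★ p855012 `charLocIntNear_of_finite`.
Hence socket #11's conclusion holds, token for token (`N = 3`, `H = Φ₃`, carrier `Gqs L v`, any Haar `μ`), for EVERY constituent `c` of `i_G(χ_St(ψ₀))`.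

* §1 `continuous_halfModulusChar_sq_inv_apply` — the first component `(‖·‖^{1∕2}·‖·‖^{1∕2})⁻¹` of `χ_St` has continuous value.
* §2 **`charLocIntNearSemisimple_of_isConstituentOf_cmPrincipalSeries_st`** — socket #11's conclusion for every constituent of `i_G(χ_St(ψ₀))` (leaf (3c) + the case-(1)
  part of leaf (3a) of the census); **`charLocIntNearSemisimple_stG`** — the same stated on the Steinberg field `stG ψ` of any `(ι, detZ, detG, stG)` satisfying the
  «ST-PIN★» clauses (the shape the §12.5 datum files carry).

HONEST LABEL.  HC_CM is proved only modulo the 7 printed citations (2 remaining named inputs: hLiu418 = `stmt-HodgeConjecture-24832`, h413 = `stmt-HodgeConjecture-24833`)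
until rung 0 closes; socket #11 (`∀ N`, `∀ v`) stays OPEN; this by-class leaf is count-neutral.

## References
* [Rogawski1990] J. D. Rogawski, *Automorphic Representations of Unitary Groups in Three Variables*, Ann. of Math. Stud. 123 (1990), §12.2 (1) pp. 172–173; §4.9 p. 54.
* [vanDijk1972] G. van Dijk, *Computation of certain induced characters of 𝔭-adic groups*, Math. Ann. 199 (1972) 229–240, Theorem p. 237.
* [Casselman1995] W. Casselman, *Introduction to the theory of admissible representations of 𝔭-adic reductive groups* (1995), Cor. 7.1.2 p. 67.
* [HarishChandra1999] Harish-Chandra (notes by S. DeBacker, P. J. Sally), *Admissible Invariant Distributions on Reductive p-adic Groups*, ULS 16 (1999), Thm. 16.3.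
-/

set_option autoImplicit false
set_option linter.dupNamespace false  -- the mandated namespace repeats the single-problem summit's segment (`HodgeConjecture.HodgeConjecture`)

noncomputable section

open MeasureTheory Measure Set Filter Topology Function NumberField IsDedekindDomain
open Literature.NumberTheory.Automorphic Literature.NumberTheory.Automorphic.UnitaryGroup Literature.NumberTheory.Rogawski1990
open scoped ENNReal NNReal MatrixGroups

namespace Summit.HodgeConjecture.HodgeConjecture.Cruxes.H413.K2E3CharLocIntSteinbergClasses

variable (L : Type) [Field L] [NumberField L] [IsCMField L] (v : HeightOneSpectrum (𝓞 ↥(maximalRealSubfield L)))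

/-! ## §1 Continuity of the first component of `χ_St` -/

omit [IsCMField L] in
/-- The character `(‖·‖^{1∕2} · ‖·‖^{1∕2})⁻¹ = ‖·‖_E^{-1}` of `E_v^×` (first component of `χ_St`) has continuous `ℂ`-value. [cite: Rogawski1990, §12.2 (1) p. 172] -/
theorem continuous_halfModulusChar_sq_inv_apply :
    Continuous fun x : (LocalRing L v)ˣ =>
      (((halfModulusChar (LocalRing L v) * halfModulusChar (LocalRing L v))⁻¹ x : ℂˣ) : ℂ) := by
  have h := continuous_halfModulusChar_apply L v
  have heq : (fun x : (LocalRing L v)ˣ => (((halfModulusChar (LocalRing L v) * halfModulusChar (LocalRing L v))⁻¹ x : ℂˣ) : ℂ)) =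
      fun x => (((halfModulusChar (LocalRing L v) x : ℂˣ) : ℂ) * ((halfModulusChar (LocalRing L v) x : ℂˣ) : ℂ))⁻¹ := by
    funext x
    simp only [MonoidHom.inv_apply, MonoidHom.mul_apply, Units.val_inv_eq_inv_val, Units.val_mul]
  rw [heq]
  exact (h.mul h).inv₀ fun x => mul_ne_zero (Units.ne_zero _) (Units.ne_zero _)

/-! ## §2 Socket #11 for the constituents of `i_G(χ_St(ψ₀))` -/

set_option synthInstance.maxHeartbeats 400000 in
set_option maxHeartbeats 3200000 in
-- statement-heavy: `IsConstituentOf (cmPrincipalSeries …)` and `smoothTrace (G := Gqs L v) (cmPrincipalSeries …)` (class of ★ `F0P3cStCharTSPs2Kind3`)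
/-- **SOCKET #11 ON THE STEINBERG FIELD `stG ψ`** of any «ST-PIN★» quadruple: let `detZ : G →* Z(G)` and `detG, stG : Hom_c(Z(G), ℂˣ) → Irr(G)` satisfy, at a continuous
central character `ψ`, `detG ψ = ⟦ℂ_{ψ∘detZ}⟧` (kernel open), `stG ψ ≠ detG ψ`, and the JH clause `JH(i_G(χ)) = {stG ψ, detG ψ}` for a torus character `χ = (χ₁, χ₂)` with
continuous components.  Then socket #11's conclusion holds for `c = stG ψ`: by length two (★ N3) and admissibility, `Tr stG ψ = Tr i_G(χ) − Tr ℂ_{ψ∘detZ}` on `C_c^∞(G)`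
(★ additivity), and ★ p856814 represents the right-hand side by an `L¹_loc` function near every point.
[cite: Rogawski1990, §12.2 (1) pp. 172–173; §4.9 p. 54] [cite: vanDijk1972, Theorem p. 237] [cite: Casselman1995, Cor. 7.1.2 p. 67] -/
theorem charLocIntNearSemisimple_stG (hns : ∀ w : PlacesOver L v, IsCMField.complexConj L • w.1 = w.1)
    [MeasurableSpace (Gqs L v)] [BorelSpace (Gqs L v)] (μ : Measure (Gqs L v)) [μ.IsHaarMeasure]
    (detZ : Gqs L v →* ↥(Subgroup.center (Gqs L v))) (detG stG : (↥(Subgroup.center (Gqs L v)) →* ℂˣ) → IrrClass (Gqs L v))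
    (ψ : ↥(Subgroup.center (Gqs L v)) →* ℂˣ) (hopen : IsOpen (((ψ.comp detZ).ker : Subgroup (Gqs L v)) : Set (Gqs L v)))
    (hdetG : detG ψ = IrrClass.mk (SmoothIrrep.ofChar (ψ.comp detZ) hopen)) (hne : stG ψ ≠ detG ψ)
    (χ₁ : (LocalRing L v)ˣ →* ℂˣ) (χ₂ : ↥(normOneUnits (conjLocal L (IsCMField.complexConj L) v)) →* ℂˣ)
    (hc1 : Continuous fun x => ((χ₁ x : ℂˣ) : ℂ)) (hc2 : Continuous fun x => ((χ₂ x : ℂˣ) : ℂ))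
    (hJH : ∀ c : IrrClass (Gqs L v), c.IsConstituentOf (cmPrincipalSeries L 3 v (cmTorusCharPair L v χ₁ χ₂)) ↔ (c = stG ψ ∨ c = detG ψ)) :
    ∀ s : Gqs L v,
      Module.End.IsSemisimple (Matrix.toLin' ((s.val : GL (Fin 3) (UnitaryGroup.LocalRing L v)).val : Matrix (Fin 3) (Fin 3) (UnitaryGroup.LocalRing L v))) →
        ∃ U : Set (Gqs L v), IsOpen U ∧ s ∈ U ∧
          ∃ Θ : Gqs L v → ℂ, IntegrableOn Θ U μ ∧
            ∀ f : Gqs L v → ℂ, f ∈ SchwartzBruhat (Gqs L v) → tsupport f ⊆ U →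
              (stG ψ).smoothTrace μ f = ∫ g, f g * Θ g ∂μ := by
  haveI := locallyCompactSpace_cmBorelU L 3 v
  -- continuity of `χ`, admissibility and «no 3-chains» of `i_G(χ)`
  have hχ : Continuous fun t => ((cmTorusCharPair L v χ₁ χ₂ t : ℂˣ) : ℂ) := continuous_cmTorusCharPair_apply L v χ₁ χ₂ hc1 hc2
  have hadm : Representation.IsAdmissible (G := Gqs L v) (cmPrincipalSeries L 3 v (cmTorusCharPair L v χ₁ χ₂)) :=
    F0P3XiUnramNonsplitInstance.isAdmissible_cmPrincipalSeries L v _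
  have hlen : ∀ N₁ N₂ : Subrepresentation (cmPrincipalSeries L 3 v (cmTorusCharPair L v χ₁ χ₂)), ¬ (⊥ < N₁ ∧ N₁ < N₂ ∧ N₂ < ⊤) :=
    F0P3U3PrincipalSeriesLettersHold.u3PrincipalSeriesLengthLeTwo_holds L v hns χ₁ χ₂ hc1 hc2
  have hJH' : ∀ c : IrrClass (Gqs L v), c.IsConstituentOf (cmPrincipalSeries L 3 v (cmTorusCharPair L v χ₁ χ₂)) ↔ (c = detG ψ ∨ c = stG ψ) :=
    fun c => (hJH c).trans or_comm
  -- the one-dimensional constituent as a finite-dimensional smooth representation on `ℂ`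
  have hπ₁ : ((Representation.trivial ℂ (Gqs L v) ℂ).twist (ψ.comp detZ)).IsSmooth := (SmoothIrrep.ofChar (ψ.comp detZ) hopen).isSmooth
  -- `Tr stG ψ = Tr i_G(χ) − Tr ℂ_{ψ∘detZ}` on test functions
  have hsub : ∀ f : Gqs L v → ℂ, f ∈ SchwartzBruhat (Gqs L v) →
      (stG ψ).smoothTrace μ f = Representation.smoothTrace (G := Gqs L v) (cmPrincipalSeries L 3 v (cmTorusCharPair L v χ₁ χ₂)) μ f -
        ((Representation.trivial ℂ (Gqs L v) ℂ).twist (ψ.comp detZ)).smoothTrace μ f := by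
    intro f _
    have hadd := F0P3cStCharTSPs2Kind3.smoothTrace_eq_add_of_constituents_eq_pair (stG ψ) (detG ψ) hne μ f hadm hlen hJH'
    have hdet : (detG ψ).smoothTrace μ f = ((Representation.trivial ℂ (Gqs L v) ℂ).twist (ψ.comp detZ)).smoothTrace μ f := by
      rw [hdetG, IrrClass.smoothTrace_mk]
      rfl
    linear_combination hadd - hdet
  exact K2E3CharLocIntDifferenceOfRepresented.charLocIntNearSemisimple_of_smoothTrace_eq_cmPrincipalSeries_sub_finite L v hns μ
    (cmTorusCharPair L v χ₁ χ₂) hχ ((Representation.trivial ℂ (Gqs L v) ℂ).twist (ψ.comp detZ)) hπ₁ (stG ψ) hsub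

set_option synthInstance.maxHeartbeats 400000 in
set_option maxHeartbeats 3200000 in
-- statement-heavy (as above)
/-- **SOCKET #11 FOR EVERY CONSTITUENT OF A CASE-(1) PRINCIPAL SERIES `i_G(χ_St(ψ₀))`** (`N = 3`, `H = Φ₃`, `v` NON-SPLIT, any Haar `μ`; `μZ` any Haar measure on `G ⧸ Z(G)`,
only used to call ★ «ST-PIN★»).  For a character `ψ₀` of `E¹_v` with continuous value and ANY `c ∈ Irr(U(Φ₃)(L⁺_v))` that is a constituent of
`i_G((‖·‖^{1∕2}‖·‖^{1∕2})⁻¹, ψ₀)`: for every semisimple `s` there are an open `U ∋ s` and `Θ ∈ L¹(U, μ)` with `χ_c(f) = ∫ f Θ dμ` for all `f ∈ C_c^∞(G)` supported in `U`.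
The constituents are `St_G(ψ)` (§2 `charLocIntNearSemisimple_stG`, van Dijk minus the one-dimensional character) and `ψ∘det` (★ p855012 `charLocIntNear_of_finite`) by ★
«ST-PIN★» ∕ «ST-JH★».  Leaf (3c) of the ROW-11 census, closed outright. [cite: Rogawski1990, §12.2 (1) pp. 172–173; §4.9 p. 54] [cite: vanDijk1972, Theorem p. 237]
[cite: HarishChandra1999, Thm. 16.3] [cite: Casselman1995, Cor. 7.1.2 p. 67] -/
theorem charLocIntNearSemisimple_of_isConstituentOf_cmPrincipalSeries_st (hns : ∀ w : PlacesOver L v, IsCMField.complexConj L • w.1 = w.1)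
    [MeasurableSpace (Gqs L v)] [BorelSpace (Gqs L v)] (μ : Measure (Gqs L v)) [μ.IsHaarMeasure]
    [MeasurableSpace (Gqs L v ⧸ Subgroup.center (Gqs L v))] [BorelSpace (Gqs L v ⧸ Subgroup.center (Gqs L v))]
    (μZ : Measure (Gqs L v ⧸ Subgroup.center (Gqs L v))) [μZ.IsHaarMeasure]
    (ψ₀ : ↥(normOneUnits (conjLocal L (IsCMField.complexConj L) v)) →* ℂˣ) (hψ₀ : Continuous fun x => ((ψ₀ x : ℂˣ) : ℂ))
    (c : IrrClass (Gqs L v))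
    (hc : c.IsConstituentOf (cmPrincipalSeries L 3 v
      (cmTorusCharPair L v (halfModulusChar (LocalRing L v) * halfModulusChar (LocalRing L v))⁻¹ ψ₀))) :
    ∀ s : Gqs L v,
      Module.End.IsSemisimple (Matrix.toLin' ((s.val : GL (Fin 3) (UnitaryGroup.LocalRing L v)).val : Matrix (Fin 3) (Fin 3) (UnitaryGroup.LocalRing L v))) →
        ∃ U : Set (Gqs L v), IsOpen U ∧ s ∈ U ∧
          ∃ Θ : Gqs L v → ℂ, IntegrableOn Θ U μ ∧
            ∀ f : Gqs L v → ℂ, f ∈ SchwartzBruhat (Gqs L v) → tsupport f ⊆ U →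
              c.smoothTrace μ f = ∫ g, f g * Θ g ∂μ := by
  intro s hs
  -- the «ST-PIN★» fields and the central character `ψ` through `ψ₀`
  obtain ⟨ι, detZ, detG, stG, hιc, -, hι, -, hfields, -⟩ := F0P3cStCharTSStPin.exists_stDetFields L v hns μZ
  obtain ⟨ψ, hψc, hcomp⟩ := F0P3cStCharTSStJH.exists_centerChar_comp_eq L v hns ι hιc hι ψ₀
    (F0P3cStCharTSStJH.continuous_of_continuous_val ψ₀ hψ₀)
  subst hcomp
  obtain ⟨⟨hopen, hdetG⟩, hne, hJH, -⟩ := hfields ψ hψc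
  rcases (hJH c).1 hc with h | h
  · -- the Steinberg-type constituent
    subst h
    exact charLocIntNearSemisimple_stG L v hns μ detZ detG stG ψ hopen hdetG hne _ _
      (continuous_halfModulusChar_sq_inv_apply L v) hψ₀ hJH s hs
  · -- the one-dimensional constituent `ψ∘det`
    subst h
    rw [hdetG]
    haveI : Module.Finite ℂ (SmoothIrrep.ofChar (G := Gqs L v) (ψ.comp detZ) hopen).V := (inferInstance : Module.Finite ℂ ℂ)
    exact K2E3CharLocIntNearSemisimpleFinDim.charLocIntNear_of_finite L 3 (qsForm L) v μ (SmoothIrrep.ofChar (ψ.comp detZ) hopen) s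

end Summit.HodgeConjecture.HodgeConjecture.Cruxes.H413.K2E3CharLocIntSteinbergClasses

end
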